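import Literature.NumberTheory.Automorphic.QuaternionTorusCentralizer
import HarnessLib

/-!
# The fibre measures of the tori of `D^×`: `α ⊗ counting` on `ℝ_{>0} K(γ)ˣ` corresponds to
# `(α ⊗ counting)|_{ℝ_{>0} Dˣ ∩ C(γ)}`, and the volume factor of a regular class is the covolume
# `vol(K(γ)_𝔸ˣ ⧸ ℝ_{>0} K(γ)ˣ)` computed inside the torus
(Gelbart, *Automorphic forms on adele groups* (1975), (10.14) and p. 154)

Topic `NumberTheory/Automorphic`. Two definitions (`arithmeticTorusMap`, `centerTorusMap`: the
maps `Tˣ → Dˣ` and `A_T = ℝ_{>0} → A_D = ℝ_{>0}` induced by `T = K(γ) ↪ D` on the rational points and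
on the centres of the two adelic group data) and theorems; no named fact, no instance. Continuation
of `QuaternionTorusCentralizer`, where the volume factor `vol(G_γ ⧸ H_γ; ν_γ, ρ_F)` of a regular
class of the `D^×` trace formula (`QuaternionUnitsTraceNormalized`) was transported along the
isomorphism of topological groups `e : T_𝔸ˣ ≃ₜ* G_γ = C_{D_𝔸ˣ}(γ)` to the torus — for fibre measures
`ρ_T` on `ℝ_{>0} Tˣ` and `ρ_F` on `H_γ = ℝ_{>0} Dˣ ∩ G_γ` *assumed* to correspond under `e`
(`units_quotientMeasure_centralizer_univ_eq_torus`). This file PROVES the correspondence for the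
fibre measures that actually occur in the trace formula:

* `inclAdelic_mem_centralizer_iff`, `mem_range_arithmeticTorusMap` — a rational unit of `D`
  centralises `γ` in `D_𝔸ˣ` iff it lies in `T`, i.e. the rational points of `H_γ` are exactly the
  image of `Tˣ` (`T` a field, `forall_isUnit_centralizer`; injectivity of `D → D_𝔸`);
* `units_restricted_eq_map_torus` — **for `α_D = (A_T → A_D)_* α_T`, the measure
  `ρ_F = ((a, δ) ↦ a δ)_* (α_D ⊗ counting)|_{H_γ}` (restricted to `ℝ_{>0} Dˣ ∩ C(γ)` and transported to
  `H_γ ≤ C(γ)`, as in `units_hasSum_norm_sq_integratedOperator_eq_tsum_covol_mul`) is the image under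
  `e|_{ℝ_{>0} Tˣ}` of `ρ_T = ((a, δ) ↦ a δ)_* (α_T ⊗ counting)`**: evaluating both on a Borel `S` as
  `Σ_δ α(section at δ)` (Mathlib `Measure.prod_apply_symm`, counting measure), the summands over
  `δ ∈ Dˣ ∖ Tˣ` vanish (such `δ` do not centralise `γ`) and those over `δ ∈ Tˣ` agree;
* `units_volume_regular_eq_torus` — **consequently `vol(G_γ ⧸ H_γ; ν_γ, ρ_F) =
  (ν_T/ρ_T)(T_𝔸ˣ ⧸ ℝ_{>0} Tˣ)`** with `ν_T = e^* ν_γ`: the volume factor of the class of `γ` in the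
  `D^×` trace formula is the covolume of `ℝ_{>0} K(γ)ˣ` in `K(γ)_𝔸ˣ` for the Haar measure `ν_T` and
  the fibre measure `α_T ⊗ counting` — Gelbart's `meas(Z'_𝔸 B_F \ B_𝔸)`, `B = K(γ)`, a quantity
  attached to the quadratic field alone (and to be met again on the `GL(2)` side, (10.15)).

Part of the inline (D-0026) decomposition of
`Literature.NumberTheory.Automorphic.strong_multiplicity_one_quaternionUnits` (Gelbart Thm. 10.5).
Not here: the comparison of the Haar measures `α_D`, `α_{GL₂}` on the two copies of `ℝ_{>0}`
through `ℝ_{>0}` itself (both are `posRealCentral`; here everything is phrased through `α_T`).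

## References

* S. Gelbart, *Automorphic forms on adele groups*, Ann. of Math. Studies 83 (1975), (10.14) and
  p. 154 [Gelbart1975].
-/

noncomputable section

open NumberField IsDedekindDomain MeasureTheory Measure Topology
open Literature.MeasureTheory.Group
open scoped NNReal ENNReal TensorProduct Pointwise

namespace Literature.NumberTheory.Automorphic

-- the coset spaces carry Borel σ-algebras supplied locally, not the quotient σ-algebra
attribute [-instance] Quotient.instMeasurableSpace QuotientGroup.measurableSpace

universe u

/-! ### The fibre measures `α ⊗ counting` correspond under the torus isomorphism -/

section FibreMeasure

variable (K : Type) [Field K] [NumberField K] (D : Type u) [Ring D] [Algebra K D]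
  [IsQuaternionAlgebra K D]

local notation "GD" => AdelicGroupData.units K D

/-- **A rational unit lies in the adelic centraliser of `γ` iff it lies in `T = K(γ)`**:
for `d ∈ Dˣ`, `inclAdelic d ∈ C_{D_𝔸ˣ}(inclAdelic γ) ↔ d ∈ T` (injectivity of `D → D_𝔸`).
[folklore] -/
theorem inclAdelic_mem_centralizer_iff (hD : ∀ x : D, x ≠ 0 → IsUnit x) (γ d : Dˣ) :
    (GD).toAdelic d ∈ Subgroup.centralizer ({(GD).toAdelic γ} : Set (GD).Adelic) ↔
      (d : D) ∈ Subalgebra.centralizer K ({(γ : D)} : Set D) := by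
  have h4 : Module.finrank K D = 4 := IsQuaternionAlgebra.finrank_eq_four (K := K) (D := D)
  haveI : Nontrivial D := Module.nontrivial_of_finrank_pos (R := K) (by omega)
  rw [Subgroup.mem_centralizer_iff, Subalgebra.mem_centralizer_iff]
  simp only [Set.mem_singleton_iff, forall_eq]
  change inclAdelic K D γ * inclAdelic K D d = inclAdelic K D d * inclAdelic K D γ ↔
    (γ : D) * d = d * γ
  constructor
  · intro h
    have h5 : inclAdelic K D (γ * d) = inclAdelic K D (d * γ) := by rw [map_mul, map_mul, h]
    exact congrArg Units.val (Units.map_injective (incl_injective_of_isUnit K D hD) h5)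
  · intro h
    have h6 : γ * d = d * γ := Units.ext h
    rw [← map_mul, ← map_mul, h6]

/-- The map of rational units `Tˣ → Dˣ` induced by `T ↪ D`, on the arithmetic subgroups:
`δ' ↦ inclAdelic (δ' : Dˣ)`; it is injective with image `Dˣ ∩ C(γ)` (`inclAdelic_mem_centralizer_iff`).
[folklore] -/
def arithmeticTorusMap (γ : Dˣ) :
    (AdelicGroupData.units K (Subalgebra.centralizer K ({(γ : D)} : Set D))).arithmeticSubgroup →
      (GD).arithmeticSubgroup := fun δ =>
  ⟨unitsMapRight K D (Subalgebra.centralizer K ({(γ : D)} : Set D)).val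
      (δ : (AdelicGroupData.units K (Subalgebra.centralizer K ({(γ : D)} : Set D))).Adelic), by
    obtain ⟨d, hd⟩ := δ.2
    refine ⟨Units.map (Subalgebra.centralizer K ({(γ : D)} : Set D)).val.toRingHom.toMonoidHom d, ?_⟩
    change inclAdelic K D _ = _
    rw [← unitsMapRight_inclAdelic]
    exact congrArg _ hd⟩

/-- `arithmeticTorusMap γ δ' = unitsMapRight T.val δ'` on underlying elements (definitional).
[folklore] -/
@[simp]
theorem coe_arithmeticTorusMap (γ : Dˣ)
    (δ : (AdelicGroupData.units K (Subalgebra.centralizer K ({(γ : D)} : Set D))).arithmeticSubgroup) :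
    ((arithmeticTorusMap K D γ δ : (GD).arithmeticSubgroup) : (GD).Adelic) =
      unitsMapRight K D (Subalgebra.centralizer K ({(γ : D)} : Set D)).val
        (δ : (AdelicGroupData.units K (Subalgebra.centralizer K ({(γ : D)} : Set D))).Adelic) := rfl

/-- `arithmeticTorusMap` is injective. [folklore] -/
theorem arithmeticTorusMap_injective (γ : Dˣ) : Function.Injective (arithmeticTorusMap K D γ) := by
  intro a b hab
  have h := congrArg (fun x : (GD).arithmeticSubgroup => (x : (GD).Adelic)) hab
  simp only [coe_arithmeticTorusMap] at h
  exact Subtype.ext (unitsMapRight_injective K D (Subalgebra.centralizer K ({(γ : D)} : Set D)).val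
    Subtype.val_injective h)

/-- **The range of `arithmeticTorusMap`**: a rational unit of `D` commuting with `γ` comes from
`Tˣ` (`T` is a field). [folklore] -/
theorem mem_range_arithmeticTorusMap (hD : ∀ x : D, x ≠ 0 → IsUnit x) (γ : Dˣ)
    {δ : (GD).arithmeticSubgroup}
    (hδ : (δ : (GD).Adelic) ∈ Subgroup.centralizer ({(GD).toAdelic γ} : Set (GD).Adelic)) :
    δ ∈ Set.range (arithmeticTorusMap K D γ) := by
  have h4 : Module.finrank K D = 4 := IsQuaternionAlgebra.finrank_eq_four (K := K) (D := D)
  haveI : Nontrivial D := Module.nontrivial_of_finrank_pos (R := K) (by omega)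
  obtain ⟨x, hx⟩ := δ
  obtain ⟨d, rfl⟩ := hx
  set dU : Dˣ := d with hdU
  have hδ' : (GD).toAdelic dU ∈ Subgroup.centralizer ({(GD).toAdelic γ} : Set (GD).Adelic) := hδ
  have hdT : (dU : D) ∈ Subalgebra.centralizer K ({(γ : D)} : Set D) :=
    (inclAdelic_mem_centralizer_iff K D hD γ dU).1 hδ'
  have hne : (⟨(dU : D), hdT⟩ : Subalgebra.centralizer K ({(γ : D)} : Set D)) ≠ 0 := fun h => by
    exact dU.ne_zero (congrArg Subtype.val h)
  obtain ⟨d', hd'⟩ := forall_isUnit_centralizer K D hD (γ : D) ⟨(dU : D), hdT⟩ hne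
  refine ⟨⟨inclAdelic K _ d', d', rfl⟩, Subtype.ext ?_⟩
  change unitsMapRight K D _ (inclAdelic K _ d') = inclAdelic K D dU
  rw [unitsMapRight_inclAdelic]
  congr 1
  exact Units.ext (by
    rw [Units.coe_map]
    change (Subalgebra.centralizer K ({(γ : D)} : Set D)).val (d' : _) = dU
    rw [hd']
    rfl)

/-- The map of the central `ℝ_{>0}`'s induced by `T ↪ D`: `w ↦ unitsMapRight T.val w`, from
`A_{T} = ℝ_{>0} ≤ T_𝔸ˣ` to `A_D = ℝ_{>0} ≤ D_𝔸ˣ` (`posRealCentral t ↦ posRealCentral t`). [folklore] -/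
def centerTorusMap (γ : Dˣ) :
    (AdelicGroupData.units K (Subalgebra.centralizer K ({(γ : D)} : Set D))).center' → (GD).center' :=
  fun w => ⟨unitsMapRight K D (Subalgebra.centralizer K ({(γ : D)} : Set D)).val
      (w : (AdelicGroupData.units K (Subalgebra.centralizer K ({(γ : D)} : Set D))).Adelic), by
    obtain ⟨t, ht⟩ := w.2
    refine ⟨t, ?_⟩
    change posRealCentral K D t = _
    rw [← unitsMapRight_posRealCentral K D (Subalgebra.centralizer K ({(γ : D)} : Set D)).val t]
    exact congrArg _ ht⟩

/-- `centerTorusMap γ w = unitsMapRight T.val w` on underlying elements (definitional). [folklore] -/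
@[simp]
theorem coe_centerTorusMap (γ : Dˣ)
    (w : (AdelicGroupData.units K (Subalgebra.centralizer K ({(γ : D)} : Set D))).center') :
    ((centerTorusMap K D γ w : (GD).center') : (GD).Adelic) =
      unitsMapRight K D (Subalgebra.centralizer K ({(γ : D)} : Set D)).val
        (w : (AdelicGroupData.units K (Subalgebra.centralizer K ({(γ : D)} : Set D))).Adelic) := rfl

/-- `centerTorusMap` is continuous. [folklore] -/
theorem continuous_centerTorusMap (γ : Dˣ) : Continuous (centerTorusMap K D γ) := by
  refine Continuous.subtype_mk ?_ _
  exact (continuous_unitsMapRight K D (Subalgebra.centralizer K ({(γ : D)} : Set D)).val).comp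
    continuous_subtype_val

/-- Membership in the image, inside `L = ℝ_{>0} Dˣ`, of a subset `S` of `H_γ = (L ∩ C(γ)) ≤ C(γ)`:
`z ∈ ι(e₁⁻¹(S))` iff `z ∈ C(γ)` and the corresponding point of `H_γ` lies in `S`. [folklore] -/
theorem mem_image_inclusion_preimage_iff (γ : Dˣ)
    (S : Set ↥(((GD).quotientSubgroup ⊓ Subgroup.centralizer ({(GD).toAdelic γ} :
      Set (GD).Adelic)).subgroupOf (Subgroup.centralizer ({(GD).toAdelic γ} : Set (GD).Adelic))))
    (z : (GD).quotientSubgroup) :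
    z ∈ Subgroup.inclusion (inf_le_left : (GD).quotientSubgroup ⊓ Subgroup.centralizer
        ({(GD).toAdelic γ} : Set (GD).Adelic) ≤ (GD).quotientSubgroup) ''
      ((Subgroup.subgroupOfEquivOfLe (inf_le_right : (GD).quotientSubgroup ⊓ Subgroup.centralizer
        ({(GD).toAdelic γ} : Set (GD).Adelic) ≤ _)).symm ⁻¹' S) ↔
      ∃ hz : (z : (GD).Adelic) ∈ Subgroup.centralizer ({(GD).toAdelic γ} : Set (GD).Adelic),
        (Subgroup.subgroupOfEquivOfLe (inf_le_right : (GD).quotientSubgroup ⊓ Subgroup.centralizer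
          ({(GD).toAdelic γ} : Set (GD).Adelic) ≤ _)).symm ⟨z, z.2, hz⟩ ∈ S := by
  constructor
  · rintro ⟨y, hy, rfl⟩
    exact ⟨y.2.2, hy⟩
  · rintro ⟨hz, h⟩
    exact ⟨⟨z, z.2, hz⟩, h, Subtype.ext rfl⟩

variable [MeasurableSpace (AdelicGroupData.units K D).Adelic] [BorelSpace (AdelicGroupData.units K D).Adelic]

/-- **The fibre measures `α ⊗ counting` of `ℝ_{>0} Tˣ` and of `H_γ = ℝ_{>0} Dˣ ∩ C(γ)` correspond
under the torus isomorphism.** Let `γ ∈ Dˣ` be regular, `T = K(γ)`, `e = unitsTorusEquiv`,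
`α_T` an s-finite measure on `A_T = ℝ_{>0} ≤ T_𝔸ˣ` and `α_D = (A_T → A_D)_* α_T` its image on
`A_D = ℝ_{>0} ≤ D_𝔸ˣ` (`centerTorusMap`, `posRealCentral t ↦ posRealCentral t`). Then the measure
`ρ_F` of the trace formula (`units_hasSum_norm_sq_integratedOperator_eq_tsum_covol_mul`: the Haar
measure `((a, δ) ↦ a δ)_* (α_D ⊗ counting)` of `L = ℝ_{>0} Dˣ` restricted to `L ∩ C(γ)` and transported
to `H_γ ≤ C(γ)`) is the image under `e|_{ℝ_{>0} Tˣ} : ℝ_{>0} Tˣ ≃ H_γ` of the Haar measure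
`((a, δ) ↦ a δ)_* (α_T ⊗ counting)` of `ℝ_{>0} Tˣ`: both count, over the rational points `δ' ∈ Tˣ`
(the rational points of `L ∩ C(γ)` being exactly the image of `Tˣ`, `mem_range_arithmeticTorusMap`),
the `α_T`-measure of the same sections. Consequently (with `units_quotientMeasure_centralizer_univ_eq_torus`)
the volume factor of the class of `γ` in the `D^×` trace formula is the covolume of `ℝ_{>0} Tˣ` in
`T_𝔸ˣ` for `ν_T = e^* ν_γ` and the fibre measure `α_T ⊗ counting` — a quantity attached to the
quadratic field `T` alone. [cite: Gelbart1975, (10.14) and p. 154] -/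
theorem units_restricted_eq_map_torus (hD : ∀ x : D, x ≠ 0 → IsUnit x) (γ : Dˣ)
    (hγ : (γ : D) ∉ (⊥ : Subalgebra K D))
    [MeasurableSpace (AdelicGroupData.units K (Subalgebra.centralizer K ({(γ : D)} : Set D))).Adelic]
    [BorelSpace (AdelicGroupData.units K (Subalgebra.centralizer K ({(γ : D)} : Set D))).Adelic]
    (αT : Measure (AdelicGroupData.units K (Subalgebra.centralizer K ({(γ : D)} : Set D))).center')
    [SFinite αT]
    (αD : Measure (GD).center') (hαD : αD = Measure.map (centerTorusMap K D γ) αT)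
    (ρH : Measure ↥((GD).quotientSubgroup ⊓ Subgroup.centralizer ({(GD).toAdelic γ} : Set (GD).Adelic)))
    (ρF : Measure ↥(((GD).quotientSubgroup ⊓ Subgroup.centralizer ({(GD).toAdelic γ} :
      Set (GD).Adelic)).subgroupOf (Subgroup.centralizer ({(GD).toAdelic γ} : Set (GD).Adelic))))
    (hρH : ρH = (Measure.map (fun p : (GD).center' × (GD).arithmeticSubgroup =>
      (⟨(p.1 : (GD).Adelic) * p.2, AdelicGroupData.mulMap_mem (GD) p⟩ : (GD).quotientSubgroup))
        (αD.prod count)).comap (Subgroup.inclusion inf_le_left))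
    (hρF : ρF = Measure.map (Subgroup.subgroupOfEquivOfLe inf_le_right).symm ρH) :
    ρF = Measure.map (subgroupCongrHomeomorph (unitsTorusEquiv K D hD γ hγ).toMulEquiv
      ((AdelicGroupData.units K (Subalgebra.centralizer K ({(γ : D)} : Set D))).quotientSubgroup)
      (((GD).quotientSubgroup ⊓ Subgroup.centralizer ({(GD).toAdelic γ} :
        Set (GD).Adelic)).subgroupOf (Subgroup.centralizer ({(GD).toAdelic γ} : Set (GD).Adelic)))
      (unitsTorusEquiv_mem_iff K D hD γ hγ) (unitsTorusEquiv K D hD γ hγ).continuous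
      (unitsTorusEquiv K D hD γ hγ).symm.continuous)
      (Measure.map (fun p : (AdelicGroupData.units K (Subalgebra.centralizer K ({(γ : D)} :
        Set D))).center' × (AdelicGroupData.units K (Subalgebra.centralizer K ({(γ : D)} :
        Set D))).arithmeticSubgroup =>
        (⟨(p.1 : (AdelicGroupData.units K (Subalgebra.centralizer K ({(γ : D)} : Set D))).Adelic) * p.2,
          AdelicGroupData.mulMap_mem (AdelicGroupData.units K (Subalgebra.centralizer K ({(γ : D)} :
            Set D))) p⟩ :
          (AdelicGroupData.units K (Subalgebra.centralizer K ({(γ : D)} : Set D))).quotientSubgroup))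
        (αT.prod count)) := by
  have h4 : Module.finrank K D = 4 := IsQuaternionAlgebra.finrank_eq_four (K := K) (D := D)
  haveI : Nontrivial D := Module.nontrivial_of_finrank_pos (R := K) (by omega)
  -- topological facts on `D_𝔸ˣ` and `T_𝔸ˣ`
  obtain ⟨i₁, i₂, i₃⟩ := units_adelic_topology K D
  haveI := i₂; haveI := i₃
  obtain ⟨j₁, j₂, j₃⟩ := units_adelic_topology K (Subalgebra.centralizer K ({(γ : D)} : Set D))
  haveI := j₂; haveI := j₃
  haveI : LocallyCompactSpace (AdeleRing (𝓞 K) K) := locallyCompactSpace_adeleRing' K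
  -- retractions, discreteness and countability of the rational points
  obtain ⟨θ, hθc, hθA, hθa, hθγ⟩ := exists_centralRetraction_units K D
  obtain ⟨θ', hθc', hθA', hθa', hθγ'⟩ := exists_centralRetraction_units K
    (Subalgebra.centralizer K ({(γ : D)} : Set D))
  haveI : Countable (GD).arithmeticSubgroup := AdelicGroupData.countable_arithmeticSubgroup_units K D
  haveI : Countable (AdelicGroupData.units K (Subalgebra.centralizer K ({(γ : D)} :
      Set D))).arithmeticSubgroup :=
    AdelicGroupData.countable_arithmeticSubgroup_units K _
  haveI : DiscreteTopology (GD).arithmeticSubgroup := AdelicGroupData.units_isDiscreteRational_holds K D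
  haveI : DiscreteTopology (AdelicGroupData.units K (Subalgebra.centralizer K ({(γ : D)} :
      Set D))).arithmeticSubgroup :=
    AdelicGroupData.units_isDiscreteRational_holds K _
  haveI : BorelSpace (GD).arithmeticSubgroup := Subtype.borelSpace _
  haveI : BorelSpace (AdelicGroupData.units K (Subalgebra.centralizer K ({(γ : D)} :
      Set D))).arithmeticSubgroup := Subtype.borelSpace _
  haveI : MeasurableSingletonClass (GD).arithmeticSubgroup := inferInstance
  haveI : MeasurableSingletonClass (AdelicGroupData.units K (Subalgebra.centralizer K ({(γ : D)} :
      Set D))).arithmeticSubgroup := inferInstance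
  haveI : BorelSpace ((GD).center' × (GD).arithmeticSubgroup) := Prod.borelSpace
  haveI : BorelSpace ((AdelicGroupData.units K (Subalgebra.centralizer K ({(γ : D)} :
      Set D))).center' × (AdelicGroupData.units K (Subalgebra.centralizer K ({(γ : D)} :
      Set D))).arithmeticSubgroup) := Prod.borelSpace
  -- the measurable embeddings
  have hmulD := AdelicGroupData.measurableEmbedding_mulMap (GD) θ hθc hθA hθa hθγ
  have hmulT := AdelicGroupData.measurableEmbedding_mulMap
    (AdelicGroupData.units K (Subalgebra.centralizer K ({(γ : D)} : Set D))) θ' hθc' hθA' hθa' hθγ'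
  have hH : IsClosed ((GD).quotientSubgroup : Set (GD).Adelic) :=
    AdelicGroupData.isClosed_quotientSubgroup_units K D
  have hmeIncl := measurableEmbedding_subgroupInclusion ((GD).quotientSubgroup ⊓
    Subgroup.centralizer ({(GD).toAdelic γ} : Set (GD).Adelic)) (GD).quotientSubgroup inf_le_left
    (hH.inter (isClosed_centralizer_singleton _))
  set e := unitsTorusEquiv K D hD γ hγ with he
  set eL := subgroupCongrHomeomorph e.toMulEquiv
      ((AdelicGroupData.units K (Subalgebra.centralizer K ({(γ : D)} : Set D))).quotientSubgroup)
      (((GD).quotientSubgroup ⊓ Subgroup.centralizer ({(GD).toAdelic γ} :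
        Set (GD).Adelic)).subgroupOf (Subgroup.centralizer ({(GD).toAdelic γ} : Set (GD).Adelic)))
      (unitsTorusEquiv_mem_iff K D hD γ hγ) e.continuous e.symm.continuous with heL
  have he₁ : Measurable (Subgroup.subgroupOfEquivOfLe (inf_le_right : (GD).quotientSubgroup ⊓
      Subgroup.centralizer ({(GD).toAdelic γ} : Set (GD).Adelic) ≤ _)).symm :=
    (continuous_subgroupOfEquivOfLe_symm _ _ _).measurable
  ext S hS
  -- unpack both sides down to `α ⊗ counting`
  rw [hρF, hρH, Measure.map_apply he₁ hS, hmeIncl.comap_apply,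
    Measure.map_apply hmulD.measurable (hmeIncl.measurableSet_image.2 (he₁ hS)), hαD,
    Measure.prod_apply_symm (hmulD.measurable (hmeIncl.measurableSet_image.2 (he₁ hS))),
    lintegral_count, Measure.map_apply eL.continuous.measurable hS,
    Measure.map_apply hmulT.measurable (eL.continuous.measurable hS),
    Measure.prod_apply_symm (hmulT.measurable (eL.continuous.measurable hS)), lintegral_count]
  -- the key pointwise identity: `e(a' δ') ∈ S ↔ (ι a') (ι δ') ∈ ι(e₁⁻¹ S)`
  have hkey : ∀ (a' : (AdelicGroupData.units K (Subalgebra.centralizer K ({(γ : D)} : Set D))).center')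
      (δ' : (AdelicGroupData.units K (Subalgebra.centralizer K ({(γ : D)} : Set D))).arithmeticSubgroup),
      ((⟨((centerTorusMap K D γ a' : (GD).center') : (GD).Adelic) *
          (arithmeticTorusMap K D γ δ' : (GD).arithmeticSubgroup),
          AdelicGroupData.mulMap_mem (GD) (centerTorusMap K D γ a', arithmeticTorusMap K D γ δ')⟩ :
            (GD).quotientSubgroup) ∈
        Subgroup.inclusion (inf_le_left : (GD).quotientSubgroup ⊓ Subgroup.centralizer
            ({(GD).toAdelic γ} : Set (GD).Adelic) ≤ (GD).quotientSubgroup) ''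
          ((Subgroup.subgroupOfEquivOfLe (inf_le_right : (GD).quotientSubgroup ⊓ Subgroup.centralizer
            ({(GD).toAdelic γ} : Set (GD).Adelic) ≤ _)).symm ⁻¹' S)) ↔
      eL ⟨(a' : (AdelicGroupData.units K (Subalgebra.centralizer K ({(γ : D)} : Set D))).Adelic) * δ',
        AdelicGroupData.mulMap_mem _ (a', δ')⟩ ∈ S := by
    intro a' δ'
    rw [mem_image_inclusion_preimage_iff]
    have hzC : ((centerTorusMap K D γ a' : (GD).center') : (GD).Adelic) *
        (arithmeticTorusMap K D γ δ' : (GD).arithmeticSubgroup) ∈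
        Subgroup.centralizer ({(GD).toAdelic γ} : Set (GD).Adelic) :=
      Subgroup.mul_mem _
        (e (a' : (AdelicGroupData.units K (Subalgebra.centralizer K ({(γ : D)} : Set D))).Adelic)).2
        (e (δ' : (AdelicGroupData.units K (Subalgebra.centralizer K ({(γ : D)} : Set D))).Adelic)).2
    have hpt : (Subgroup.subgroupOfEquivOfLe (inf_le_right : (GD).quotientSubgroup ⊓
        Subgroup.centralizer ({(GD).toAdelic γ} : Set (GD).Adelic) ≤ _)).symm
        ⟨_, AdelicGroupData.mulMap_mem (GD) (centerTorusMap K D γ a', arithmeticTorusMap K D γ δ'),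
          hzC⟩ =
        eL ⟨(a' : (AdelicGroupData.units K (Subalgebra.centralizer K ({(γ : D)} : Set D))).Adelic) * δ',
          AdelicGroupData.mulMap_mem _ (a', δ')⟩ := by
      refine Subtype.ext (Subtype.ext ?_)
      exact (map_mul (unitsMapRight K D (Subalgebra.centralizer K ({(γ : D)} : Set D)).val)
        (a' : (AdelicGroupData.units K (Subalgebra.centralizer K ({(γ : D)} : Set D))).Adelic)
        (δ' : (AdelicGroupData.units K (Subalgebra.centralizer K ({(γ : D)} : Set D))).Adelic)).symm
    constructor
    · rintro ⟨hz, h⟩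
      rwa [hpt] at h
    · intro h
      exact ⟨hzC, by rwa [hpt]⟩
  -- reindex the sum over `Dˣ` by `Tˣ`
  rw [← (arithmeticTorusMap_injective K D γ).tsum_eq]
  · refine tsum_congr fun δ' => ?_
    rw [Measure.map_apply (continuous_centerTorusMap K D γ).measurable
      (measurable_prodMk_right (hmulD.measurable (hmeIncl.measurableSet_image.2 (he₁ hS))))]
    congr 1
    ext a'
    simp only [Set.mem_preimage]
    exact hkey a' δ'
  · -- the summands vanish off the image of `Tˣ`: such `δ` do not centralise `γ`
    intro δ hδ
    by_contra hnot
    apply hδ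
    have hempty : (fun x : (GD).center' => (x, δ)) ⁻¹'
        ((fun p : (GD).center' × (GD).arithmeticSubgroup =>
          (⟨(p.1 : (GD).Adelic) * p.2, AdelicGroupData.mulMap_mem (GD) p⟩ : (GD).quotientSubgroup)) ⁻¹'
          (Subgroup.inclusion (inf_le_left : (GD).quotientSubgroup ⊓ Subgroup.centralizer
              ({(GD).toAdelic γ} : Set (GD).Adelic) ≤ (GD).quotientSubgroup) ''
            ((Subgroup.subgroupOfEquivOfLe (inf_le_right : (GD).quotientSubgroup ⊓
              Subgroup.centralizer ({(GD).toAdelic γ} : Set (GD).Adelic) ≤ _)).symm ⁻¹' S))) = ∅ := by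
      ext a
      simp only [Set.mem_preimage, Set.mem_empty_iff_false, iff_false]
      intro ha
      rw [mem_image_inclusion_preimage_iff] at ha
      obtain ⟨hz, -⟩ := ha
      apply hnot
      refine mem_range_arithmeticTorusMap K D hD γ ?_
      have ha' : ((a : (GD).Adelic))⁻¹ ∈ Subgroup.centralizer ({(GD).toAdelic γ} : Set (GD).Adelic) :=
        Subgroup.inv_mem _ (Subgroup.center_le_centralizer _ ((GD).center'_le a.2))
      have := Subgroup.mul_mem _ ha' hz
      simpa only [inv_mul_cancel_left] using this
    beta_reduce
    rw [hempty, measure_empty]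

attribute [local instance] AdelicGroupData.measurableSpaceQuotientForm
  AdelicGroupData.borelSpaceQuotientForm

/-- **The volume factor of a regular class, intrinsically**: with the fibre measures of the trace
formula built from `α_D = (A_T → A_D)_* α_T` (as in `units_restricted_eq_map_torus`) and
`ν_T = e^* ν_γ`, the volume factor `vol(G_γ ⧸ H_γ; ν_γ, ρ_F)` of the class of the regular `γ` in
`units_hasSum_norm_sq_integratedOperator_eq_tsum_covol_mul` equals the covolume of `ℝ_{>0} Tˣ` in
`T_𝔸ˣ` for `ν_T` and the fibre measure `ρ_T = ((a, δ) ↦ a δ)_* (α_T ⊗ counting)`: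

  `vol(G_γ ⧸ H_γ; ν_γ, ρ_F) = (ν_T/ρ_T)(T_𝔸ˣ ⧸ ℝ_{>0} Tˣ)`

— Gelbart's `meas(Z'_𝔸 B_F \ B_𝔸)` for `B = T = K(γ)`, computed inside the torus
(`units_quotientMeasure_centralizer_univ_eq_torus` with `units_restricted_eq_map_torus`).
[cite: Gelbart1975, (10.14) and p. 154] -/
theorem units_volume_regular_eq_torus (hD : ∀ x : D, x ≠ 0 → IsUnit x) (γ : Dˣ)
    (hγ : (γ : D) ∉ (⊥ : Subalgebra K D))
    [MeasurableSpace (AdelicGroupData.units K (Subalgebra.centralizer K ({(γ : D)} : Set D))).Adelic]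
    [BorelSpace (AdelicGroupData.units K (Subalgebra.centralizer K ({(γ : D)} : Set D))).Adelic]
    [LocallyCompactSpace (GD).Adelic] [SecondCountableTopology (GD).Adelic] [T2Space (GD).Adelic]
    [LocallyCompactSpace (AdelicGroupData.units K (Subalgebra.centralizer K ({(γ : D)} : Set D))).Adelic]
    [SecondCountableTopology
      (AdelicGroupData.units K (Subalgebra.centralizer K ({(γ : D)} : Set D))).Adelic]
    [T2Space (AdelicGroupData.units K (Subalgebra.centralizer K ({(γ : D)} : Set D))).Adelic]
    [hH : IsClosed ((GD).quotientSubgroup : Set (GD).Adelic)]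
    [hHT : IsClosed (((AdelicGroupData.units K (Subalgebra.centralizer K ({(γ : D)} :
      Set D))).quotientSubgroup) :
        Set (AdelicGroupData.units K (Subalgebra.centralizer K ({(γ : D)} : Set D))).Adelic)]
    [hCcl : IsClosed ((Subgroup.centralizer ({(GD).toAdelic γ} : Set (GD).Adelic) :
      Subgroup (GD).Adelic) : Set (GD).Adelic)]
    [MeasurableSpace (↥(Subgroup.centralizer ({(GD).toAdelic γ} : Set (GD).Adelic)) ⧸
      ((GD).quotientSubgroup ⊓ Subgroup.centralizer ({(GD).toAdelic γ} : Set (GD).Adelic)).subgroupOf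
        (Subgroup.centralizer ({(GD).toAdelic γ} : Set (GD).Adelic)))]
    [BorelSpace (↥(Subgroup.centralizer ({(GD).toAdelic γ} : Set (GD).Adelic)) ⧸
      ((GD).quotientSubgroup ⊓ Subgroup.centralizer ({(GD).toAdelic γ} : Set (GD).Adelic)).subgroupOf
        (Subgroup.centralizer ({(GD).toAdelic γ} : Set (GD).Adelic)))]
    (αT : Measure (AdelicGroupData.units K (Subalgebra.centralizer K ({(γ : D)} : Set D))).center')
    [SFinite αT]
    (αD : Measure (GD).center') (hαD : αD = Measure.map (centerTorusMap K D γ) αT)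
    (ρH : Measure ↥((GD).quotientSubgroup ⊓ Subgroup.centralizer ({(GD).toAdelic γ} : Set (GD).Adelic)))
    (ρF : Measure ↥(((GD).quotientSubgroup ⊓ Subgroup.centralizer ({(GD).toAdelic γ} :
      Set (GD).Adelic)).subgroupOf (Subgroup.centralizer ({(GD).toAdelic γ} : Set (GD).Adelic))))
    [ρF.IsMulLeftInvariant] [IsFiniteMeasureOnCompacts ρF] [ρF.IsOpenPosMeasure] [ρF.IsInvInvariant]
    [SFinite ρF]
    (hρH : ρH = (Measure.map (fun p : (GD).center' × (GD).arithmeticSubgroup =>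
      (⟨(p.1 : (GD).Adelic) * p.2, AdelicGroupData.mulMap_mem (GD) p⟩ : (GD).quotientSubgroup))
        (αD.prod count)).comap (Subgroup.inclusion inf_le_left))
    (hρF : ρF = Measure.map (Subgroup.subgroupOfEquivOfLe inf_le_right).symm ρH)
    (νC : Measure (Subgroup.centralizer ({(GD).toAdelic γ} : Set (GD).Adelic)))
    [IsHaarMeasure νC] [νC.IsMulRightInvariant]
    (νT : Measure (AdelicGroupData.units K (Subalgebra.centralizer K ({(γ : D)} : Set D))).Adelic)
    [IsHaarMeasure νT] [νT.IsMulRightInvariant]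
    (hν : νC = Measure.map (unitsTorusEquiv K D hD γ hγ) νT)
    (ρT : Measure ↥((AdelicGroupData.units K (Subalgebra.centralizer K ({(γ : D)} :
      Set D))).quotientSubgroup))
    [ρT.IsMulLeftInvariant] [IsFiniteMeasureOnCompacts ρT] [ρT.IsOpenPosMeasure] [ρT.IsInvInvariant]
    [SFinite ρT]
    (hρT : ρT = Measure.map (fun p : (AdelicGroupData.units K (Subalgebra.centralizer K ({(γ : D)} :
        Set D))).center' × (AdelicGroupData.units K (Subalgebra.centralizer K ({(γ : D)} :
        Set D))).arithmeticSubgroup =>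
        (⟨(p.1 : (AdelicGroupData.units K (Subalgebra.centralizer K ({(γ : D)} : Set D))).Adelic) * p.2,
          AdelicGroupData.mulMap_mem (AdelicGroupData.units K (Subalgebra.centralizer K ({(γ : D)} :
            Set D))) p⟩ :
          (AdelicGroupData.units K (Subalgebra.centralizer K ({(γ : D)} : Set D))).quotientSubgroup))
        (αT.prod count)) :
    quotientMeasure (((GD).quotientSubgroup ⊓ Subgroup.centralizer ({(GD).toAdelic γ} :
        Set (GD).Adelic)).subgroupOf (Subgroup.centralizer ({(GD).toAdelic γ} : Set (GD).Adelic)))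
        ρF (isClosed_subgroupOf _ _ (hH.inter hCcl)) νC Set.univ =
      quotientMeasure ((AdelicGroupData.units K (Subalgebra.centralizer K ({(γ : D)} :
        Set D))).quotientSubgroup) ρT hHT νT Set.univ := by
  refine units_quotientMeasure_centralizer_univ_eq_torus K D hD γ hγ νC ρF νT ρT hν ?_
  rw [hρT]
  exact units_restricted_eq_map_torus K D hD γ hγ αT αD hαD ρH ρF hρH hρF

end FibreMeasure

end Literature.NumberTheory.Automorphic
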